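import Mathlib
import HarnessLib
import Summits.NavierStokesRegularity.NavierStokesRegularity.Theorems.TaoLadderRungTwoBreakEternalRigidityViscBddOneUniformActionHalfLife

/-!
# Crux `TaoLadderRungTwoBreak.EternalRigidityViscBddOne` (stmt-NavierStokesRegularity-20420), stub (ω4): ONE co-moving envelope —
# the anchor-scale wake calming (WC) follows from the half-life envelope with GEOMETRIC wake decay, so (ω4) ⟸ (ω3) ∧ (FE) ∧ (HLg)

MODEL lattice ODEs only (Tao 2016 §4, `m = 4`, registered vocabulary `ViscousUpTo`/`BlowsUpAt`/`TypeOne` of skeleton `85fbfe8e90eea58b`);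
nothing here is a statement about the Navier–Stokes equations; no stub, crux or summit is closed (`--supports` ⟨20420⟩).

After `…UniformActionHalfLife` the typed residual of (ω4) was (FE) ∧ (WC) ∧ (HL): two overlapping wake hypotheses — g19's (WC)
«`Λ^{n+F}(t⋆−t_a)‖X_{n+F}(t)‖ ≤ P n` for ALL `t ≥ t_a`» (used for the forward-envelope clause `bdd` of the limit) and the half-life
co-moving envelope (HL) with summable profile `p` (used for the `action` clause).  Here (WC) is DERIVED from (HL) once the wake side of
`p` decays geometrically at the dissipation-clock rate, `p n ≤ p₀ (1+ε₀)^{2n}` (`wakeCalming_of_geometricHalfLife`): for `t ≥ t_a` pick the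
dyadic block `2^j ≤ (t⋆−t_a)/(t⋆−t) < 2^{j+1}`, apply (HL) at the anchor `s_j = t⋆ − (t⋆−t_a)/2^j` with its own front `G`, and pay the
factor `2^j` with the clock: the lower clock at `s_j` and the upper clock at `t_a` give `2^j (1+ε₀)^{2(F−G)} < K₁/m₁`, so
`P n = p₀ (K₁/m₁) (1+ε₀)^{2n}`.  Hence `eternalLimitViscBdd_of_geometricHalfLifeWake`: the registered conclusion of (ω4) from
`ViscousUpTo ∧ BlowsUpAt ∧ TypeOne`, (FE) and the single envelope hypothesis (HLg) = (HL) ∧ «`p ≥ 0` summable, `p n ≤ p₀(1+ε₀)^{2n}`»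
(both clauses hold for a discretely self-similar trajectory at the a = 1 balance whose period profile decays ahead of the front and
whose wake is damped at least at the clock rate).  HONEST LABEL: bookkeeping; (FE), (HLg), (ω3), (ω4), ⟨20420⟩ and every NS statement
remain OPEN; rung 0.
-/

noncomputable section

-- the summit and its single sub-problem share the name (CONVENTIONS §1)
set_option linter.dupNamespace false

open Set Filter Topology MeasureTheory
open Literature.Analysis.FluidPDE Literature.Analysis.FluidPDE.TaoCascade
open Summit.NavierStokesRegularity.NavierStokesRegularity.Theorems.BlowupRigidityOne
open Summit.NavierStokesRegularity.NavierStokesRegularity.Theorems.MinimalViscousBlowup.ThresholdRay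
open Summit.NavierStokesRegularity.NavierStokesRegularity.Theorems.EternalRigidityViscBddOne.Birth
open Summit.NavierStokesRegularity.NavierStokesRegularity.Theorems.EternalRigidityViscBddOne.CriticalRate
open Summit.NavierStokesRegularity.NavierStokesRegularity.Theorems.EternalRigidityViscBddOne.CriticalFront
open Summit.NavierStokesRegularity.NavierStokesRegularity.Theorems.EternalRigidityViscBddOne.FrontClock
open Summit.NavierStokesRegularity.NavierStokesRegularity.Theorems.EternalRigidityViscBddOne.ViscousLawLimit

namespace Summit.NavierStokesRegularity.NavierStokesRegularity.Theorems.EternalRigidityViscBddOne.UniformAction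

/-- **(WC) ⟸ TYPE I + (FE) + geometric half-life wake.**  For a regular `ν`-viscous trajectory blowing up at `t⋆` at the type-I rate with
the front a=1 envelope (FE): if after every late anchor `t_a` with front shell `F` the half-life co-moving envelope (HL) holds with a profile
`p` whose wake side decays at the clock rate, `p n ≤ p₀ (1+ε₀)^{2n}`, then g19's anchor-scale wake calming (WC) holds for ALL later times:
`Λ^{n+F}(t⋆−t_a)‖X_{n+F}(t)‖ ≤ p₀ (K₁/m₁) (1+ε₀)^{2n}` for `t ∈ [t_a, t⋆)` (two-sided clock `m₁ ≤ ν(1+ε₀)^{2F}(t⋆−t) < K₁`).  MODEL lattice only.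
[cite: Tao2016AveragedNS, §4 Thm. 4.2 (statement shape), the viscous equation before it, §6.4; cell vocabulary (stmt-NavierStokesRegularity-20420, stub (ω4))] -/
theorem wakeCalming_of_geometricHalfLife {R ε₀ ν : ℝ} (hε₀ : 0 < ε₀) (hν : 0 < ν)
    {α : Fin 4 → Fin 4 → Fin 4 → ℤ × ℤ × ℤ → ℝ} (hα : InTableClass R α) {X₀ : Fin 4 → ℝ}
    {X : Fin 4 → ℤ → ℝ → ℝ} {tStar : ℝ} (hV : ViscousUpTo ε₀ ν α X₀ X tStar) (hB : BlowsUpAt ε₀ X tStar)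
    (hT1 : TypeOne ε₀ X tStar)
    (hEnv : ∃ Q t₂ : ℝ, t₂ < tStar ∧ ∀ t : ℝ, 0 ≤ t → t₂ ≤ t → t < tStar → ∀ (i : Fin 4) (F : ℤ),
      1 / (32 * (3 + bigLam ε₀)) ≤ bigLam ε₀ ^ F * |X i F t| * (tStar - t) →
        (1 + ε₀) ^ ((F : ℝ) / 2) * |X i F t| ≤ Q)
    {p : ℤ → ℝ} {p₀ : ℝ} (hpg : ∀ n : ℤ, p n ≤ p₀ * (1 + ε₀) ^ ((2 : ℝ) * n))
    (hHL : ∃ t₃ : ℝ, t₃ < tStar ∧ ∀ ta : ℝ, 0 ≤ ta → t₃ ≤ ta → ta < tStar → ∀ (i : Fin 4) (F : ℤ),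
      1 / (32 * (3 + bigLam ε₀)) ≤ bigLam ε₀ ^ F * |X i F ta| * (tStar - ta) →
        ∀ (n : ℤ) (t : ℝ), ta ≤ t → t ≤ ta + (tStar - ta) / 2 →
          bigLam ε₀ ^ (n + F) * (tStar - ta) * ‖shellVec X (n + F) t‖ ≤ p n) :
    ∃ (P : ℤ → ℝ) (t₃ : ℝ), t₃ < tStar ∧ ∀ ta : ℝ, 0 ≤ ta → t₃ ≤ ta → ta < tStar → ∀ (i : Fin 4) (F : ℤ),
      1 / (32 * (3 + bigLam ε₀)) ≤ bigLam ε₀ ^ F * |X i F ta| * (tStar - ta) →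
        ∀ (n : ℤ) (t : ℝ), ta ≤ t → t < tStar →
          bigLam ε₀ ^ (n + F) * (tStar - ta) * ‖shellVec X (n + F) t‖ ≤ P n := by
  have hl0 : (0 : ℝ) < 1 + ε₀ := by linarith
  have hε : (-1 : ℝ) < ε₀ := by linarith
  have hΛ : 0 < bigLam ε₀ := bigLam_pos hε
  have hT : 0 < tStar := hV.pos
  set cs : ℝ := 1 / (32 * (3 + bigLam ε₀)) with hcs
  have hcs0 : 0 < cs := by rw [hcs]; positivity
  obtain ⟨K₁, t₁, hK₁, ht₁T, hclock⟩ := frontClock_of_typeOne hε₀ hν hα hV hT1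
  obtain ⟨Q, t₂, ht₂T, henv⟩ := hEnv
  obtain ⟨t₃, ht₃T, hhl⟩ := hHL
  set t₀ : ℝ := max (max t₁ t₂) (max t₃ 0) with ht₀
  have ht₀T : t₀ < tStar := max_lt (max_lt ht₁T ht₂T) (max_lt ht₃T hT)
  have h0t₀ : 0 ≤ t₀ := (le_max_right _ _).trans (le_max_right _ _)
  have h1t₀ : t₁ ≤ t₀ := (le_max_left _ _).trans (le_max_left _ _)
  have h2t₀ : t₂ ≤ t₀ := (le_max_right _ _).trans (le_max_left _ _)
  have h3t₀ : t₃ ≤ t₀ := (le_max_left _ _).trans (le_max_right _ _)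
  have hfront : ∀ t : ℝ, 0 ≤ t → t < tStar →
      ∃ (i : Fin 4) (F : ℤ), cs ≤ bigLam ε₀ ^ F * |X i F t| * (tStar - t) :=
    fun t ht0 htT => typeOne_quantity_lower_bound hε₀ hν hα hV hB t ht0 htT
  choose! iF FF hFF using hfront
  have hQpos : 0 < Q := by
    have h := henv t₀ h0t₀ h2t₀ ht₀T (iF t₀) (FF t₀) (hFF t₀ h0t₀ ht₀T)
    have hX : X (iF t₀) (FF t₀) t₀ ≠ 0 := by
      intro h0
      have := hFF t₀ h0t₀ ht₀T
      rw [h0, abs_zero, mul_zero, zero_mul] at this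
      exact absurd this (not_le.2 hcs0)
    exact lt_of_lt_of_le (mul_pos (Real.rpow_pos_of_pos hl0 _) (abs_pos.2 hX)) h
  set m₁ : ℝ := cs * ν / Q with hm₁
  have hm₁0 : 0 < m₁ := by rw [hm₁]; positivity
  -- lower clock at every late critical-front mode, upper clock likewise
  have hlow : ∀ t : ℝ, t₀ ≤ t → t < tStar → ∀ (i : Fin 4) (F : ℤ),
      cs ≤ bigLam ε₀ ^ F * |X i F t| * (tStar - t) → m₁ ≤ ν * (1 + ε₀) ^ ((2 : ℝ) * F) * (tStar - t) := by
    intro t ht htT i F hF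
    have ht0 : 0 ≤ t := h0t₀.trans ht
    exact lowerClock_of_frontEnvelope hε hν.le hcs0 hF (henv t ht0 (h2t₀.trans ht) htT i F hF)
  have hup : ∀ t : ℝ, t₀ ≤ t → t < tStar → ∀ (i : Fin 4) (F : ℤ),
      cs ≤ bigLam ε₀ ^ F * |X i F t| * (tStar - t) → ν * (1 + ε₀) ^ ((2 : ℝ) * F) * (tStar - t) < K₁ := by
    intro t ht htT i F hF
    exact hclock t (h0t₀.trans ht) (h1t₀.trans ht) htT i F hF
  refine ⟨fun n => p₀ * (K₁ / m₁) * (1 + ε₀) ^ ((2 : ℝ) * n), t₀, ht₀T, ?_⟩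
  intro ta hta0 hta htaT i F hF n t htat htT
  have hgap : 0 < tStar - ta := by linarith
  have htt : 0 < tStar - t := by linarith
  -- the dyadic block of `t` relative to the anchor `ta`
  have hx1 : (1 : ℝ) ≤ (tStar - ta) / (tStar - t) := by
    rw [le_div_iff₀ htt]
    linarith
  obtain ⟨j, hj1, hj2⟩ := exists_nat_pow_near hx1 (by norm_num : (1 : ℝ) < 2)
  have h2j : (0 : ℝ) < 2 ^ j := by positivity
  set s : ℝ := tStar - (tStar - ta) / 2 ^ j with hsdef
  have hsT : tStar - s = (tStar - ta) / 2 ^ j := by rw [hsdef]; ring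
  have hs_lt : s < tStar := by
    have : 0 < (tStar - ta) / 2 ^ j := by positivity
    linarith
  have hs_ge : ta ≤ s := by
    have h1 : (tStar - ta) / 2 ^ j ≤ tStar - ta := div_le_self hgap.le (one_le_pow₀ (by norm_num))
    rw [hsdef]
    linarith
  have hst : s ≤ t := by
    -- `t⋆ − t ≤ (t⋆ − ta)/2^j`
    have : tStar - t ≤ (tStar - ta) / 2 ^ j := by
      rw [le_div_iff₀ h2j]
      have := (le_div_iff₀ htt).1 hj1
      linarith
    rw [hsdef]
    linarith
  have ht2 : t ≤ s + (tStar - s) / 2 := by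
    -- `(t⋆ − ta)/2^{j+1} ≤ t⋆ − t`
    have h2j1 : (0 : ℝ) < 2 ^ (j + 1) := by positivity
    have : (tStar - ta) / 2 ^ (j + 1) ≤ tStar - t := by
      rw [div_le_iff₀ h2j1]
      have := (div_lt_iff₀ htt).1 hj2
      linarith
    rw [hsT, pow_succ] at *
    have h3 : (tStar - ta) / (2 ^ j * 2) = (tStar - ta) / 2 ^ j / 2 := by rw [div_div]
    rw [h3] at this
    linarith
  have h0s : 0 ≤ s := hta0.trans hs_ge
  have ht₀s : t₀ ≤ s := hta.trans hs_ge
  -- (HL) at the anchor `s` with its own front `G = FF s`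
  have hG := hFF s h0s hs_lt
  have h := hhl s h0s (h3t₀.trans ht₀s) hs_lt (iF s) (FF s) hG (n + F - FF s) t hst ht2
  rw [sub_add_cancel] at h
  -- the clocks: upper at `ta` for `(i,F)`, lower at `s` for `(iF s, FF s)`
  have hu := hup ta hta htaT i F hF
  have hl := hlow s ht₀s hs_lt (iF s) (FF s) hG
  rw [hsT] at hl
  -- `2^j (1+ε₀)^{2(F − G)} ≤ K₁/m₁`
  set qF : ℝ := (1 + ε₀) ^ ((2 : ℝ) * F) with hqF
  set qG : ℝ := (1 + ε₀) ^ ((2 : ℝ) * FF s) with hqG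
  have hqF0 : 0 < qF := Real.rpow_pos_of_pos hl0 _
  have hqG0 : 0 < qG := Real.rpow_pos_of_pos hl0 _
  have hA : m₁ * 2 ^ j ≤ ν * qG * (tStar - ta) := by
    have := mul_le_mul_of_nonneg_right hl h2j.le
    rwa [mul_assoc (ν * qG), div_mul_cancel₀ _ h2j.ne'] at this
  have hratio : 2 ^ j * qF ≤ K₁ / m₁ * qG := by
    -- from `m₁ 2^j ≤ ν qG (t⋆−ta)` and `ν qF (t⋆−ta) < K₁`
    rw [div_mul_eq_mul_div, le_div_iff₀ hm₁0]
    have h1 : 2 ^ j * qF * m₁ = qF * (m₁ * 2 ^ j) := by ring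
    rw [h1]
    calc qF * (m₁ * 2 ^ j) ≤ qF * (ν * qG * (tStar - ta)) := mul_le_mul_of_nonneg_left hA hqF0.le
      _ = qG * (ν * qF * (tStar - ta)) := by ring
      _ ≤ qG * K₁ := mul_le_mul_of_nonneg_left hu.le hqG0.le
      _ = K₁ * qG := by ring
  -- the geometric profile at the shifted index
  have hpn : p (n + F - FF s) ≤ p₀ * ((1 + ε₀) ^ ((2 : ℝ) * n) * qF / qG) := by
    refine (hpg _).trans (le_of_eq ?_)
    have hcast : ((2 : ℝ) * ((n + F - FF s : ℤ) : ℝ)) = 2 * (n : ℝ) + 2 * (F : ℝ) - 2 * (FF s : ℝ) := by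
      push_cast
      ring
    rw [hcast, Real.rpow_sub hl0, Real.rpow_add hl0, hqF, hqG]
  have hp0' : 0 ≤ p (n + F - FF s) :=
    le_trans (by positivity) h
  -- assemble: LHS = 2^j · [Λ^{n+F}(t⋆−s)‖X_{n+F}(t)‖] ≤ 2^j p(…) ≤ p₀ (K₁/m₁) (1+ε₀)^{2n}
  have hscale : bigLam ε₀ ^ (n + F) * (tStar - ta) * ‖shellVec X (n + F) t‖
      = 2 ^ j * (bigLam ε₀ ^ (n + F) * (tStar - s) * ‖shellVec X (n + F) t‖) := by
    rw [hsT]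
    field_simp
  rw [hscale]
  have hpow0 : 0 ≤ (1 + ε₀) ^ ((2 : ℝ) * n) := (Real.rpow_pos_of_pos hl0 _).le
  calc 2 ^ j * (bigLam ε₀ ^ (n + F) * (tStar - s) * ‖shellVec X (n + F) t‖)
      ≤ 2 ^ j * p (n + F - FF s) := mul_le_mul_of_nonneg_left h h2j.le
    _ ≤ 2 ^ j * (p₀ * ((1 + ε₀) ^ ((2 : ℝ) * n) * qF / qG)) := mul_le_mul_of_nonneg_left hpn h2j.le
    _ = p₀ * (1 + ε₀) ^ ((2 : ℝ) * n) * ((2 ^ j * qF) / qG) := by ring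
    _ ≤ p₀ * (1 + ε₀) ^ ((2 : ℝ) * n) * ((K₁ / m₁ * qG) / qG) := by
        have hp₀0 : 0 ≤ p₀ := by
          -- `0 ≤ p (…) ≤ p₀ (1+ε₀)^{…}` forces `p₀ ≥ 0`
          have h1 := hp0'.trans (hpg (n + F - FF s))
          exact nonneg_of_mul_nonneg_left h1 (Real.rpow_pos_of_pos hl0 _)
        exact mul_le_mul_of_nonneg_left (div_le_div_of_nonneg_right hratio hqG0.le)
          (mul_nonneg hp₀0 hpow0)
    _ = p₀ * (K₁ / m₁) * (1 + ε₀) ^ ((2 : ℝ) * n) := by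
        rw [mul_div_assoc, div_self hqG0.ne']
        ring

/-- **(ω4) ⟸ (ω3) ∧ (FE) ∧ (HLg) — one co-moving envelope.**  The registered conclusion shape of `stub_eternalLimitViscBdd` —
`∃ ν̂ W, IsEternalVisc ε₀ ν̂ α W ∧ UniformBound W ∧ EternalSurvivingFwd 1 ε₀ W` (with `ν̂ > 0`, `‖W_0(0)‖ ≥ 1/(32(3+Λ))`) — from
`ViscousUpTo ∧ BlowsUpAt ∧ TypeOne`, the front a=1 envelope (FE) and the half-life co-moving envelope (HL) with a profile `p ≥ 0` that is
summable and decays on the wake side at the clock rate, `p n ≤ p₀(1+ε₀)^{2n}`; (WC) comes from `wakeCalming_of_geometricHalfLife`, (UA) from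
`uniformCriticalAction_of_halfLifeWake`.  MODEL lattice only; (FE), (HLg), (ω3) and ⟨20420⟩ remain OPEN.
[cite: Tao2016AveragedNS, §4 Thm. 4.2 (statement shape), the viscous equation before it, §6.4; KochNadirashviliSereginSverak2009, Thm 1.1 ff.; cell vocabulary (stmt-NavierStokesRegularity-20420)] -/
theorem eternalLimitViscBdd_of_geometricHalfLifeWake {R ε₀ ν : ℝ} (hε₀ : 0 < ε₀) (hν : 0 < ν)
    {α : Fin 4 → Fin 4 → Fin 4 → ℤ × ℤ × ℤ → ℝ} (hα : InTableClass R α) {X₀ : Fin 4 → ℝ}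
    {X : Fin 4 → ℤ → ℝ → ℝ} {tStar : ℝ} (hV : ViscousUpTo ε₀ ν α X₀ X tStar) (hB : BlowsUpAt ε₀ X tStar)
    (hT1 : TypeOne ε₀ X tStar)
    (hEnv : ∃ Q t₂ : ℝ, t₂ < tStar ∧ ∀ t : ℝ, 0 ≤ t → t₂ ≤ t → t < tStar → ∀ (i : Fin 4) (F : ℤ),
      1 / (32 * (3 + bigLam ε₀)) ≤ bigLam ε₀ ^ F * |X i F t| * (tStar - t) →
        (1 + ε₀) ^ ((F : ℝ) / 2) * |X i F t| ≤ Q)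
    {p : ℤ → ℝ} (hp0 : ∀ n, 0 ≤ p n) (hps : Summable p)
    {p₀ : ℝ} (hpg : ∀ n : ℤ, p n ≤ p₀ * (1 + ε₀) ^ ((2 : ℝ) * n))
    (hHL : ∃ t₃ : ℝ, t₃ < tStar ∧ ∀ ta : ℝ, 0 ≤ ta → t₃ ≤ ta → ta < tStar → ∀ (i : Fin 4) (F : ℤ),
      1 / (32 * (3 + bigLam ε₀)) ≤ bigLam ε₀ ^ F * |X i F ta| * (tStar - ta) →
        ∀ (n : ℤ) (t : ℝ), ta ≤ t → t ≤ ta + (tStar - ta) / 2 →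
          bigLam ε₀ ^ (n + F) * (tStar - ta) * ‖shellVec X (n + F) t‖ ≤ p n) :
    ∃ νh : ℝ, 0 < νh ∧ ∃ W : ℤ → ℝ → Em 4,
      IsEternalVisc ε₀ νh α W ∧ UniformBound W ∧ EternalSurvivingFwd 1 ε₀ W ∧
        1 / (32 * (3 + bigLam ε₀)) ≤ ‖W 0 0‖ := by
  obtain ⟨P, hWC⟩ := wakeCalming_of_geometricHalfLife hε₀ hν hα hV hB hT1 hEnv hpg hHL
  exact eternalLimitViscBdd_of_halfLifeWake hε₀ hν hα hV hB hT1 hEnv hWC hp0 hps hHL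

end Summit.NavierStokesRegularity.NavierStokesRegularity.Theorems.EternalRigidityViscBddOne.UniformAction

end
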